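import Summits.HodgeConjecture.HodgeConjecture.Theses.AnchorTransport
import Literature.AlgebraicGeometry.HodgeTheory.MotivatedClassesDeformation
import Literature.AlgebraicGeometry.HodgeTheory.MotivatedClassesAlgebraic
import Literature.AlgebraicGeometry.Motives.VarietiesGeometricallyIntegralProofs
import Literature.AlgebraicGeometry.HodgeTheory.FermatHypersurfaceReduction
import Literature.AlgebraicGeometry.HodgeTheory.ComplexConjugation
import Literature.AlgebraicGeometry.HodgeTheory.HodgeConjecture
import Literature.AlgebraicGeometry.Motives.ComplexPointsEhresmann
import Literature.AlgebraicGeometry.Motives.ComplexPointsManifold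
import Literature.AlgebraicGeometry.Motives.CompleteIntersectionLinesThroughPoints
import Literature.NumberTheory.Transcendental.Analytification
import Mathlib.Topology.JacobsonSpace

/-!
# Route AnchorTransport — `VariationalHodge` (stmt-HodgeConjecture-1076): sandwich, extreme degrees, reduction to affine bases

The crux `AnchorTransport.VariationalHodge` is Grothendieck's variational Hodge conjecture in
global-class form on the tree's real carriers: for a smooth projective family `f : 𝒳 ⟶ S`
(`Motives.IsSmoothProjectiveFamily f n`: smooth of relative dimension `n`, proper, every complex fibre
a smooth projective variety) over a smooth IRREDUCIBLE `ℂ`-scheme `S` and a class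
`A ∈ H²ᵖ(𝒳(ℂ); ℂ)` all of whose fibre restrictions are rational of Hodge type `(p, p)`, algebraicity
of `A|_{𝒳_{s₀}}` at ONE complex point forces algebraicity of `A|_{𝒳_s}` at EVERY complex point
(Charles–Schnell, *Notes on absolute Hodge classes*, Conj. 11.3.1 = Grothendieck 1966, footnote 13).

This file records what is provable about the decl AS TYPED, unconditionally:

* `variationalHodge_of_hodgeConjecture` — the Hodge conjecture implies the crux (Charles–Schnell
  Cor. 11.3.6), using only the fibrewise hypotheses AT the target point `s`: a refutation of the crux
  is a refutation of the summit.
* `variationalHodge_conclusion_zero`, `variationalHodge_conclusion_of_lt` — the conclusion of the crux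
  holds outright in codimension `p = 0` (`algebraicClasses_zero`) and for `p > n`
  (`H²ᵖ(𝒳_s(ℂ); ℂ) = 0`, the fibre being a closed `2n`-manifold).
* `forall_complexPoints_of_affineOpens`, `variationalHodge_of_affine(_of_stable)` — **the crux
  follows from its restriction to smooth irreducible AFFINE bases** (chain of affine opens through a
  closed point of their intersection — the base is Jacobson; base change of the family,
  `Motives.familyPullback`, moving hypotheses, anchor and conclusion across `fiberOverFamilyPullbackIso`);
  every printed engine wants at least a quasi-projective base, this supplies it for any line.
* `variationalHodge_projective_of_affine`, `variationalHodge_projective_of_standardConjectureB` — for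
  PROJECTIVE smooth families (`f` a closed immersion into `ℙᴺ × S` followed by the projection: the
  hypothesis shape of the printed conjecture and of the tree's `Andre1996_deformation`, which the decl
  does NOT carry — `IsSmoothProjectiveFamily` is smooth + proper + projective fibres only): reduction
  to affine bases, and **the Lefschetz standard conjecture `B` implies the variational Hodge statement**
  granted the named facts `Andre1996_deformation`, `Andre1996_motivatedClasses_le_algebraicClasses_of_standardConjectureB`,
  `nonempty_hardLefschetzNFold` (Charles–Schnell, remark after Thm. 11.3.8, via André 1996 Thm. 0.5).
* `variationalHodge_of_standardConjectureB_of_relProjective` — hence `B` ⇒ the crux AS FILED granted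
  also relative projectivity of its families (hypothesis `hproj`, false in general: Atiyah-flop
  families): the exact difference between the decl and the printed conjecture, as one hypothesis.
-/

noncomputable section

-- every declaration of this problem lives in `Summit.HodgeConjecture.HodgeConjecture.…` (summit = sub-problem)
set_option linter.dupNamespace false

open CategoryTheory AlgebraicGeometry TopologicalSpace MonoidalCategory
open Literature.AlgebraicGeometry.Motives Literature.AlgebraicGeometry.HodgeTheory
open Summit.HodgeConjecture.HodgeConjecture.Theses.AnchorTransport

namespace Summit.HodgeConjecture.HodgeConjecture.Theorems

/-! ### The sandwich: HC ⇒ V -/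

/-- **The Hodge conjecture implies the variational Hodge crux** (Charles–Schnell, Cor. 11.3.6, here
even without the theorem of the fixed part because the crux assumes the Hodge condition on every
fibre): apply `HodgeConjecture` to the smooth projective fibre `𝒳_s` and the rational `(p,p)` class
`A|_{𝒳_s}`. Irreducibility and smoothness of the base and the anchor are not used. [folklore] -/
theorem variationalHodge_of_hodgeConjecture : _root_.HodgeConjecture → VariationalHodge := by
  intro h n 𝒳 S f hf _ _ p A hA _ s
  exact (h (hf.isSmoothProjective s)).2 p _ (hA s).1 (hA s).2

/-! ### The extreme degrees -/

/-- **Codimension `0`**: the conclusion of the crux holds for every family and every class, since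
`algebraicClasses _ 0 = H⁰` (`algebraicClasses_zero`). [folklore] -/
theorem variationalHodge_conclusion_zero {𝒳 S : SchemeOver ℂ} (f : 𝒳 ⟶ S)
    (A : complexBetti 𝒳 (2 * 0)) (s : ComplexPoints S) :
    complexBetti.map (fiberι f s) (2 * 0) A ∈ algebraicClasses (fiberOver f s) 0 :=
  hodgeConjectureFor_codim_zero _

/-- **Degrees above the dimension**: for `p > n` the conclusion of the crux holds for every smooth
projective family of relative dimension `n`, because `H²ᵖ(𝒳_s(ℂ); ℂ) = 0` — the fibre is a smooth
projective `n`-fold, so `𝒳_s(ℂ)` is a closed `2n`-manifold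
(`Motives.ComplexPoints.subsingleton_singularCohomology_of_lt`). [folklore] -/
theorem variationalHodge_conclusion_of_lt {n : ℕ} {𝒳 S : SchemeOver ℂ} (f : 𝒳 ⟶ S)
    (hf : IsSmoothProjectiveFamily f n) {p : ℕ} (hp : n < p) (A : complexBetti 𝒳 (2 * p))
    (s : ComplexPoints S) :
    complexBetti.map (fiberι f s) (2 * p) A ∈ algebraicClasses (fiberOver f s) p := by
  haveI := ComplexPoints.subsingleton_singularCohomology_of_lt (hf.isSmoothProjective s) ℂ
    (k := 2 * p) (by omega)
  rw [Subsingleton.elim (complexBetti.map (fiberι f s) (2 * p) A) 0]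
  exact Submodule.zero_mem _

/-- **The crux is its own restriction to the degrees `0 < p ≤ n`**: in codimension `0` and above the
relative dimension the conclusion holds outright (`variationalHodge_conclusion_zero`,
`variationalHodge_conclusion_of_lt`). [folklore] -/
theorem variationalHodge_of_pos_of_le :
    (∀ ⦃n : ℕ⦄ ⦃𝒳 S : SchemeOver ℂ⦄ (f : 𝒳 ⟶ S), IsSmoothProjectiveFamily f n →
      IrreducibleSpace S.left → AlgebraicGeometry.Smooth S.hom →
      ∀ (p : ℕ), 0 < p → p ≤ n → ∀ (A : complexBetti 𝒳 (2 * p)),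
      (∀ s : ComplexPoints S, IsRationalClass (complexBetti.map (fiberι f s) (2 * p) A) ∧
        IsOfHodgeType n (fiberOver f s) (2 * p) p p (complexBetti.map (fiberι f s) (2 * p) A)) →
      (∃ s₀ : ComplexPoints S,
        complexBetti.map (fiberι f s₀) (2 * p) A ∈ algebraicClasses (fiberOver f s₀) p) →
      ∀ s : ComplexPoints S,
        complexBetti.map (fiberι f s) (2 * p) A ∈ algebraicClasses (fiberOver f s) p) →
    VariationalHodge := by
  intro h n 𝒳 S f hf hirr hsm p A hA hs₀ s
  rcases Nat.eq_zero_or_pos p with rfl | hp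
  · exact variationalHodge_conclusion_zero f A s
  rcases le_or_gt p n with hle | hlt
  · exact h f hf hirr hsm p hp hle A hA hs₀ s
  · exact variationalHodge_conclusion_of_lt f hf hlt A s

/-! ### Chains of affine opens on an irreducible base -/

/-- **Propagation along affine pieces.** On an irreducible `ℂ`-scheme locally of finite type, a
property `P` of complex points which passes from `a` to `b` whenever `a`, `b` lie in a common affine
open passes from any `s₀` to any `s`: affine opens `U₀ ∋ pt s₀`, `U ∋ pt s` meet (irreducibility), the
open `U₀ ∩ U` contains a closed point (Jacobson, Mathlib `nonempty_inter_closedPoints`) underlying a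
complex point `u` (`Motives.EsnaultLevineViehweg.exists_algPoints_pt_eq`); go `s₀ → u → s`. [folklore] -/
theorem forall_complexPoints_of_affineOpens {S : SchemeOver ℂ} [IrreducibleSpace S.left]
    [LocallyOfFiniteType S.hom] (P : ComplexPoints S → Prop)
    (step : ∀ U : S.left.Opens, IsAffineOpen U → ∀ a b : ComplexPoints S,
      a.pt ∈ U → b.pt ∈ U → P a → P b)
    {s₀ : ComplexPoints S} (h₀ : P s₀) (s : ComplexPoints S) : P s := by
  haveI : JacobsonSpace S.left := LocallyOfFiniteType.jacobsonSpace S.hom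
  obtain ⟨U₀, hU₀, hs₀U₀, -⟩ := exists_isAffineOpen_mem_and_subset (U := ⊤) (x := s₀.pt) trivial
  obtain ⟨U, hU, hsU, -⟩ := exists_isAffineOpen_mem_and_subset (U := ⊤) (x := s.pt) trivial
  have hne : ((U₀ : Set S.left) ∩ (U : Set S.left)).Nonempty := by
    obtain ⟨x, -, hx⟩ := (PreirreducibleSpace.isPreirreducible_univ (X := S.left)) _ _ U₀.isOpen
      U.isOpen ⟨s₀.pt, Set.mem_univ _, hs₀U₀⟩ ⟨s.pt, Set.mem_univ _, hsU⟩
    exact ⟨x, hx⟩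
  obtain ⟨y, ⟨hyU₀, hyU⟩, hy⟩ :=
    nonempty_inter_closedPoints hne (U₀.isOpen.inter U.isOpen).isLocallyClosed
  obtain ⟨u, rfl⟩ := EsnaultLevineViehweg.exists_algPoints_pt_eq (X := S) (k := ℂ) hy
  exact step U hU u s hyU hsU (step U₀ hU₀ s₀ u hs₀U₀ hyU₀ h₀)

/-! ### Transport of the data of the crux along a base change -/

section Transport

variable {n p : ℕ} {𝒳 S S' : SchemeOver ℂ} (f : 𝒳 ⟶ S) (g : S' ⟶ S)

/-- **The fibrewise hypotheses move to the base change**: if every restriction `A|_{𝒳_s}` is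
rational of type `(p, p)`, so is every restriction of `pr_𝒳^* A` to a fibre of `𝒳 ×_S S' ⟶ S'`
(the fibre over `s'` is the fibre of `f` over `g s'`: `map_fiberι_familyPullback`,
`IsRationalClass.map`, `IsOfHodgeType.map_of_iso`). [folklore] -/
theorem familyPullback_fibrewise_rational_hodgeType (A : complexBetti 𝒳 (2 * p))
    (hA : ∀ s : ComplexPoints S, IsRationalClass (complexBetti.map (fiberι f s) (2 * p) A) ∧
      IsOfHodgeType n (fiberOver f s) (2 * p) p p (complexBetti.map (fiberι f s) (2 * p) A))
    (s' : ComplexPoints S') :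
    IsRationalClass (complexBetti.map (fiberι (familyPullback.snd f g) s') (2 * p)
        (complexBetti.map (familyPullback.fst f g) (2 * p) A)) ∧
      IsOfHodgeType n (fiberOver (familyPullback.snd f g) s') (2 * p) p p
        (complexBetti.map (fiberι (familyPullback.snd f g) s') (2 * p)
          (complexBetti.map (familyPullback.fst f g) (2 * p) A)) := by
  rw [map_fiberι_familyPullback]
  exact ⟨(hA _).1.map _, (hA _).2.map_of_iso _⟩

/-- **Algebraicity of the restrictions is invariant under base change**: for a smooth projective
family `f`, the restriction of `pr_𝒳^* A` to `(𝒳 ×_S S')_{s'}` is algebraic iff the restriction of `A`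
to `𝒳_{g s'}` is (transport along the isomorphism of smooth projective fibres
`fiberOverFamilyPullbackIso`, `mem_algebraicClasses_map_of_iso`, `map_hom_map_inv_apply`; the
`motivatedClasses` analogue is the tree's `map_fiberι_familyPullback_mem_motivatedClasses_iff`).
[folklore] -/
theorem map_fiberι_familyPullback_mem_algebraicClasses_iff (hf : IsSmoothProjectiveFamily f n)
    (A : complexBetti 𝒳 (2 * p)) (s' : ComplexPoints S') :
    complexBetti.map (fiberι (familyPullback.snd f g) s') (2 * p)
        (complexBetti.map (familyPullback.fst f g) (2 * p) A) ∈
          algebraicClasses (fiberOver (familyPullback.snd f g) s') p ↔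
      complexBetti.map (fiberι f (AlgPoints.map g s')) (2 * p) A ∈
        algebraicClasses (fiberOver f (AlgPoints.map g s')) p := by
  rw [map_fiberι_familyPullback]
  refine ⟨fun h => ?_, fun h => mem_algebraicClasses_map_of_iso (hf.isSmoothProjective _)
    ((hf.familyPullback_snd g).isSmoothProjective s') (fiberOverFamilyPullbackIso f g s') h⟩
  have back := mem_algebraicClasses_map_of_iso ((hf.familyPullback_snd g).isSmoothProjective s')
    (hf.isSmoothProjective _) (fiberOverFamilyPullbackIso f g s').symm h
  have hid : complexBetti.map (fiberOverFamilyPullbackIso f g s').symm.hom (2 * p)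
      (complexBetti.map (fiberOverFamilyPullbackIso f g s').hom (2 * p)
        (complexBetti.map (fiberι f (AlgPoints.map g s')) (2 * p) A)) =
      complexBetti.map (fiberι f (AlgPoints.map g s')) (2 * p) A :=
    map_hom_map_inv_apply (fiberOverFamilyPullbackIso f g s').symm (2 * p) _
  rwa [hid] at back

end Transport

/-! ### Reduction to affine bases -/

/-- **One step inside an affine open**, for families carrying an extra property `Q` stable under base
change along open immersions of the base (`Q = ⊤` for the crux as filed; `Q f` = "`f` is projective
in Hartshorne's sense" below). If the variational Hodge statement holds for `Q`-families over smooth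
irreducible AFFINE bases, then for a `Q`-family over a smooth irreducible `S` algebraicity of `A|_{𝒳_a}`
passes to `A|_{𝒳_b}` whenever `pt a`, `pt b` lie in a common affine open `U ⊆ S`: restrict the family to
`U` (`Motives.openSubschemeOver`, affine, irreducible as a non-empty open of an irreducible space, smooth
over `ℂ`), lift `a`, `b` to `U` (`AlgPoints.range_map_of_isOpenImmersion_holds`), move the data to the
base change and the conclusion back (`map_fiberι_familyPullback_mem_algebraicClasses_iff`). [folklore] -/
theorem variationalHodge_step_of_affine (Q : ∀ ⦃𝒳 S : SchemeOver ℂ⦄, (𝒳 ⟶ S) → Prop)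
    (hQ : ∀ ⦃𝒳 S S' : SchemeOver ℂ⦄ (f : 𝒳 ⟶ S) (g : S' ⟶ S), IsOpenImmersion g.left →
      Q f → Q (familyPullback.snd f g))
    (h : ∀ ⦃n : ℕ⦄ ⦃𝒳 S : SchemeOver ℂ⦄ (f : 𝒳 ⟶ S), IsSmoothProjectiveFamily f n → Q f →
      IrreducibleSpace S.left → IsAffine S.left → AlgebraicGeometry.Smooth S.hom →
      ∀ (p : ℕ) (A : complexBetti 𝒳 (2 * p)),
      (∀ s : ComplexPoints S, IsRationalClass (complexBetti.map (fiberι f s) (2 * p) A) ∧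
        IsOfHodgeType n (fiberOver f s) (2 * p) p p (complexBetti.map (fiberι f s) (2 * p) A)) →
      (∃ s₀ : ComplexPoints S,
        complexBetti.map (fiberι f s₀) (2 * p) A ∈ algebraicClasses (fiberOver f s₀) p) →
      ∀ s : ComplexPoints S,
        complexBetti.map (fiberι f s) (2 * p) A ∈ algebraicClasses (fiberOver f s) p)
    {n : ℕ} {𝒳 S : SchemeOver ℂ} (f : 𝒳 ⟶ S) (hf : IsSmoothProjectiveFamily f n) (hQf : Q f)
    [IrreducibleSpace S.left] [AlgebraicGeometry.Smooth S.hom] (p : ℕ) (A : complexBetti 𝒳 (2 * p))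
    (hA : ∀ s : ComplexPoints S, IsRationalClass (complexBetti.map (fiberι f s) (2 * p) A) ∧
      IsOfHodgeType n (fiberOver f s) (2 * p) p p (complexBetti.map (fiberι f s) (2 * p) A))
    (U : S.left.Opens) (hU : IsAffineOpen U) (a b : ComplexPoints S) (haU : a.pt ∈ U) (hbU : b.pt ∈ U)
    (ha : complexBetti.map (fiberι f a) (2 * p) A ∈ algebraicClasses (fiberOver f a) p) :
    complexBetti.map (fiberι f b) (2 * p) A ∈ algebraicClasses (fiberOver f b) p := by
  -- the affine open `U` as a smooth irreducible affine `ℂ`-scheme `g : U ⟶ S`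
  haveI : IsOpenImmersion (openSubschemeOverι S U).left := inferInstanceAs (IsOpenImmersion U.ι)
  have hUaff : IsAffine (openSubschemeOver S U).left := hU
  have hUirr : IrreducibleSpace (openSubschemeOver S U).left := by
    change IrreducibleSpace U
    exact isIrreducible_iff_irreducibleSpace.mp ⟨⟨a.pt, haU⟩,
      (PreirreducibleSpace.isPreirreducible_univ (X := S.left)).open_subset U.isOpen
        (Set.subset_univ _)⟩
  have hUsm : AlgebraicGeometry.Smooth (openSubschemeOver S U).hom := by
    change AlgebraicGeometry.Smooth (U.ι ≫ S.hom)
    infer_instance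
  -- lift `a`, `b` to `U`
  have hrange : Set.range (AlgPoints.map (L := ℂ) (openSubschemeOverι S U)) = {P | P.pt ∈ U} := by
    rw [AlgPoints.range_map_of_isOpenImmersion_holds]
    ext P
    change P.pt ∈ U.ι.opensRange ↔ P.pt ∈ U
    rw [Scheme.Opens.opensRange_ι]
  obtain ⟨a', rfl⟩ : a ∈ Set.range (AlgPoints.map (L := ℂ) (openSubschemeOverι S U)) := by
    rw [hrange]; exact haU
  obtain ⟨b', rfl⟩ : b ∈ Set.range (AlgPoints.map (L := ℂ) (openSubschemeOverι S U)) := by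
    rw [hrange]; exact hbU
  -- base change to `U`, apply the affine statement, and come back
  rw [← map_fiberι_familyPullback_mem_algebraicClasses_iff f (openSubschemeOverι S U) hf A b']
  exact h (familyPullback.snd f (openSubschemeOverι S U)) (hf.familyPullback_snd _)
    (hQ f _ inferInstance hQf) hUirr hUaff hUsm p
    (complexBetti.map (familyPullback.fst f (openSubschemeOverι S U)) (2 * p) A)
    (familyPullback_fibrewise_rational_hodgeType f (openSubschemeOverι S U) A hA)
    ⟨a', (map_fiberι_familyPullback_mem_algebraicClasses_iff f (openSubschemeOverι S U) hf A a').2 ha⟩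
    b'

/-- **Reduction to affine bases for `Q`-families** (`forall_complexPoints_of_affineOpens` +
`variationalHodge_step_of_affine`): the variational Hodge statement for `Q`-families over smooth
irreducible affine bases gives it over all smooth irreducible bases. [folklore] -/
theorem variationalHodge_of_affine_of_stable (Q : ∀ ⦃𝒳 S : SchemeOver ℂ⦄, (𝒳 ⟶ S) → Prop)
    (hQ : ∀ ⦃𝒳 S S' : SchemeOver ℂ⦄ (f : 𝒳 ⟶ S) (g : S' ⟶ S), IsOpenImmersion g.left →
      Q f → Q (familyPullback.snd f g))
    (h : ∀ ⦃n : ℕ⦄ ⦃𝒳 S : SchemeOver ℂ⦄ (f : 𝒳 ⟶ S), IsSmoothProjectiveFamily f n → Q f →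
      IrreducibleSpace S.left → IsAffine S.left → AlgebraicGeometry.Smooth S.hom →
      ∀ (p : ℕ) (A : complexBetti 𝒳 (2 * p)),
      (∀ s : ComplexPoints S, IsRationalClass (complexBetti.map (fiberι f s) (2 * p) A) ∧
        IsOfHodgeType n (fiberOver f s) (2 * p) p p (complexBetti.map (fiberι f s) (2 * p) A)) →
      (∃ s₀ : ComplexPoints S,
        complexBetti.map (fiberι f s₀) (2 * p) A ∈ algebraicClasses (fiberOver f s₀) p) →
      ∀ s : ComplexPoints S,
        complexBetti.map (fiberι f s) (2 * p) A ∈ algebraicClasses (fiberOver f s) p)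
    ⦃n : ℕ⦄ ⦃𝒳 S : SchemeOver ℂ⦄ (f : 𝒳 ⟶ S) (hf : IsSmoothProjectiveFamily f n) (hQf : Q f)
    (hirr : IrreducibleSpace S.left) (hsm : AlgebraicGeometry.Smooth S.hom) (p : ℕ)
    (A : complexBetti 𝒳 (2 * p))
    (hA : ∀ s : ComplexPoints S, IsRationalClass (complexBetti.map (fiberι f s) (2 * p) A) ∧
      IsOfHodgeType n (fiberOver f s) (2 * p) p p (complexBetti.map (fiberι f s) (2 * p) A))
    (hs₀ : ∃ s₀ : ComplexPoints S,
      complexBetti.map (fiberι f s₀) (2 * p) A ∈ algebraicClasses (fiberOver f s₀) p)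
    (s : ComplexPoints S) :
    complexBetti.map (fiberι f s) (2 * p) A ∈ algebraicClasses (fiberOver f s) p := by
  obtain ⟨s₀, hs₀⟩ := hs₀
  haveI := hirr
  haveI := hsm
  exact forall_complexPoints_of_affineOpens
    (fun t => complexBetti.map (fiberι f t) (2 * p) A ∈ algebraicClasses (fiberOver f t) p)
    (fun U hU a b haU hbU ha =>
      variationalHodge_step_of_affine Q hQ h f hf hQf p A hA U hU a b haU hbU ha) hs₀ s

/-- **The crux reduces to affine bases.** If Grothendieck's variational Hodge statement holds for
smooth projective families over smooth irreducible AFFINE `ℂ`-schemes, it holds over every smooth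
irreducible `ℂ`-scheme (`variationalHodge_of_affine_of_stable` with `Q = ⊤`). Neither separatedness
nor quasi-compactness of the base is needed. [folklore] -/
theorem variationalHodge_of_affine :
    (∀ ⦃n : ℕ⦄ ⦃𝒳 S : SchemeOver ℂ⦄ (f : 𝒳 ⟶ S), IsSmoothProjectiveFamily f n →
      IrreducibleSpace S.left → IsAffine S.left → AlgebraicGeometry.Smooth S.hom →
      ∀ (p : ℕ) (A : complexBetti 𝒳 (2 * p)),
      (∀ s : ComplexPoints S, IsRationalClass (complexBetti.map (fiberι f s) (2 * p) A) ∧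
        IsOfHodgeType n (fiberOver f s) (2 * p) p p (complexBetti.map (fiberι f s) (2 * p) A)) →
      (∃ s₀ : ComplexPoints S,
        complexBetti.map (fiberι f s₀) (2 * p) A ∈ algebraicClasses (fiberOver f s₀) p) →
      ∀ s : ComplexPoints S,
        complexBetti.map (fiberι f s) (2 * p) A ∈ algebraicClasses (fiberOver f s) p) →
    VariationalHodge :=
  fun h _ _ _ f hf hirr hsm p A hA hs₀ s =>
    variationalHodge_of_affine_of_stable (fun _ _ _ => True) (fun _ _ _ _ _ _ _ => trivial)
      (fun _ _ _ f hf _ hirr haff hsm => h f hf hirr haff hsm) f hf trivial hirr hsm p A hA hs₀ s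

/-! ### Projective families: reduction to affine bases, and `B ⇒ V` (André 1996) for them -/

/-- **The variational Hodge statement for PROJECTIVE smooth families** — `f` factoring as a closed
immersion `𝒳 ⟶ ℙᴺ × S` followed by the projection (Hartshorne II §4), the hypothesis shape of the
tree's `Andre1996_deformation` and of the printed conjecture (Charles–Schnell Conj. 11.3.1: "a smooth
projective morphism") — **reduces to smooth irreducible AFFINE bases**: relative projectivity is
stable under base change (`Motives.exists_isClosedImmersion_familyPullback`). [folklore] -/
theorem variationalHodge_projective_of_affine
    (h : ∀ ⦃n : ℕ⦄ ⦃𝒳 S : SchemeOver ℂ⦄ (f : 𝒳 ⟶ S), IsSmoothProjectiveFamily f n →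
      (∃ (N : ℕ) (ι : 𝒳 ⟶ projectiveSpace N ℂ ⊗ S), IsClosedImmersion ι.left ∧
        ι ≫ CartesianMonoidalCategory.snd (projectiveSpace N ℂ) S = f) →
      IrreducibleSpace S.left → IsAffine S.left → AlgebraicGeometry.Smooth S.hom →
      ∀ (p : ℕ) (A : complexBetti 𝒳 (2 * p)),
      (∀ s : ComplexPoints S, IsRationalClass (complexBetti.map (fiberι f s) (2 * p) A) ∧
        IsOfHodgeType n (fiberOver f s) (2 * p) p p (complexBetti.map (fiberι f s) (2 * p) A)) →
      (∃ s₀ : ComplexPoints S,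
        complexBetti.map (fiberι f s₀) (2 * p) A ∈ algebraicClasses (fiberOver f s₀) p) →
      ∀ s : ComplexPoints S,
        complexBetti.map (fiberι f s) (2 * p) A ∈ algebraicClasses (fiberOver f s) p)
    ⦃n : ℕ⦄ ⦃𝒳 S : SchemeOver ℂ⦄ (f : 𝒳 ⟶ S) (hf : IsSmoothProjectiveFamily f n)
    (hι : ∃ (N : ℕ) (ι : 𝒳 ⟶ projectiveSpace N ℂ ⊗ S), IsClosedImmersion ι.left ∧
      ι ≫ CartesianMonoidalCategory.snd (projectiveSpace N ℂ) S = f)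
    (hirr : IrreducibleSpace S.left) (hsm : AlgebraicGeometry.Smooth S.hom) (p : ℕ)
    (A : complexBetti 𝒳 (2 * p))
    (hA : ∀ s : ComplexPoints S, IsRationalClass (complexBetti.map (fiberι f s) (2 * p) A) ∧
      IsOfHodgeType n (fiberOver f s) (2 * p) p p (complexBetti.map (fiberι f s) (2 * p) A))
    (hs₀ : ∃ s₀ : ComplexPoints S,
      complexBetti.map (fiberι f s₀) (2 * p) A ∈ algebraicClasses (fiberOver f s₀) p)
    (s : ComplexPoints S) :
    complexBetti.map (fiberι f s) (2 * p) A ∈ algebraicClasses (fiberOver f s) p :=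
  variationalHodge_of_affine_of_stable
    (fun 𝒳 S f => ∃ (N : ℕ) (ι : 𝒳 ⟶ projectiveSpace N ℂ ⊗ S), IsClosedImmersion ι.left ∧
      ι ≫ CartesianMonoidalCategory.snd (projectiveSpace N ℂ) S = f)
    (fun _ _ _ f g _ hι => exists_isClosedImmersion_familyPullback f g hι) h f hf hι hirr hsm p A
    hA hs₀ s

/-- **The Lefschetz standard conjecture `B` implies the variational Hodge statement for projective
smooth families** (Charles–Schnell, remark after Thm. 11.3.8: "the standard conjectures imply the
variational Hodge conjecture, see [An]"), granted the tree's named facts `Andre1996_deformation`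
(André 1996, Thm. 0.5), `Andre1996_motivatedClasses_le_algebraicClasses_of_standardConjectureB`
(§2.1, remark after Déf. 1) and `nonempty_hardLefschetzNFold` (hard Lefschetz, for
`A(X) ⊆ A_mot(X)`). Over an affine base (enough by `variationalHodge_projective_of_affine`) `S` is
reduced (smooth over `ℂ`), connected (irreducible), of finite type and quasi-compact, so André's
deformation theorem applies: the algebraic anchor class is motivated, hence motivated on every fibre
(`Andre1996_deformation.map_fiber_mem_motivatedClasses_of_mem_algebraicClasses`), hence algebraic
under `B`. The same script does not apply to the crux as filed, whose families carry no embedding.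
[folklore] -/
theorem variationalHodge_projective_of_standardConjectureB
    (hB : ∀ (d : ℕ) (Z : SchemeOver ℂ) (η : complexBetti Z 2), IsSmoothProjective d Z →
      StandardConjectureBStar d Z η)
    (hBA : Andre1996_motivatedClasses_le_algebraicClasses_of_standardConjectureB)
    (hD : Andre1996_deformation) (hHL : ∀ (m : ℕ) (Y : SchemeOver ℂ), nonempty_hardLefschetzNFold m Y)
    ⦃n : ℕ⦄ ⦃𝒳 S : SchemeOver ℂ⦄ (f : 𝒳 ⟶ S) (hf : IsSmoothProjectiveFamily f n)
    (hι : ∃ (N : ℕ) (ι : 𝒳 ⟶ projectiveSpace N ℂ ⊗ S), IsClosedImmersion ι.left ∧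
      ι ≫ CartesianMonoidalCategory.snd (projectiveSpace N ℂ) S = f)
    (hirr : IrreducibleSpace S.left) (hsm : AlgebraicGeometry.Smooth S.hom) (p : ℕ)
    (A : complexBetti 𝒳 (2 * p))
    (hA : ∀ s : ComplexPoints S, IsRationalClass (complexBetti.map (fiberι f s) (2 * p) A) ∧
      IsOfHodgeType n (fiberOver f s) (2 * p) p p (complexBetti.map (fiberι f s) (2 * p) A))
    (hs₀ : ∃ s₀ : ComplexPoints S,
      complexBetti.map (fiberι f s₀) (2 * p) A ∈ algebraicClasses (fiberOver f s₀) p)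
    (s : ComplexPoints S) :
    complexBetti.map (fiberι f s) (2 * p) A ∈ algebraicClasses (fiberOver f s) p := by
  refine variationalHodge_projective_of_affine
    (fun n 𝒳 S f hf hι hirr haff hsm p A _ hs₀ s => ?_) f hf hι hirr hsm p A hA hs₀ s
  obtain ⟨s₀, hs₀⟩ := hs₀
  haveI := hirr
  haveI := hsm
  haveI := haff
  have hred : IsReduced S.left := isReduced_of_smooth_over_field S.hom
  have hqc : QuasiCompact S.hom :=
    (HasAffineProperty.iff_of_isAffine (P := @QuasiCompact)).mpr
      (isCompact_univ_iff.mp (isAffineOpen_top S.left).isCompact)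
  exact hBA hB (hf.isSmoothProjective s) p
    (Andre1996_deformation.map_fiber_mem_motivatedClasses_of_mem_algebraicClasses hD f hf hι hred
      inferInstance inferInstance hqc p A s₀ (hHL _ _) hs₀ s)

/-- **`B` ⇒ the crux AS FILED, granted relative projectivity of its families.** The decl
`VariationalHodge` quantifies over smooth PROPER families with projective fibres; if every such family
over a smooth irreducible affine base were projective in Hartshorne's sense (hypothesis `hproj` — NOT a
theorem: mixed small resolutions of a two-nodal quartic pencil, Atiyah 1958, give smooth proper
families of K3 surfaces over a smooth affine curve that are not projective over any neighbourhood of the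
special point), then `B` and the three named facts of `variationalHodge_projective_of_standardConjectureB`
would give the crux (`variationalHodge_of_affine`). This isolates `hproj` as the exact difference between
the decl and the printed conjecture it cites. [folklore] -/
theorem variationalHodge_of_standardConjectureB_of_relProjective
    (hproj : ∀ ⦃n : ℕ⦄ ⦃𝒳 S : SchemeOver ℂ⦄ (f : 𝒳 ⟶ S), IsSmoothProjectiveFamily f n →
      IrreducibleSpace S.left → IsAffine S.left → AlgebraicGeometry.Smooth S.hom →
      ∃ (N : ℕ) (ι : 𝒳 ⟶ projectiveSpace N ℂ ⊗ S), IsClosedImmersion ι.left ∧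
        ι ≫ CartesianMonoidalCategory.snd (projectiveSpace N ℂ) S = f)
    (hB : ∀ (d : ℕ) (Z : SchemeOver ℂ) (η : complexBetti Z 2), IsSmoothProjective d Z →
      StandardConjectureBStar d Z η)
    (hBA : Andre1996_motivatedClasses_le_algebraicClasses_of_standardConjectureB)
    (hD : Andre1996_deformation) (hHL : ∀ (m : ℕ) (Y : SchemeOver ℂ), nonempty_hardLefschetzNFold m Y) :
    VariationalHodge :=
  variationalHodge_of_affine fun _ _ _ f hf hirr haff hsm p A hA hs₀ s =>
    variationalHodge_projective_of_standardConjectureB hB hBA hD hHL f hf (hproj f hf hirr haff hsm)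
      hirr hsm p A hA hs₀ s

end Summit.HodgeConjecture.HodgeConjecture.Theorems

end
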